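import Summits.HodgeConjecture.HodgeConjecture.Theorems.R90S6TwistedShellParityRankOne     -- ★ W11 FILE 2b (brings ★ FILE 2 ∕ 1b ∕ 1: `thetaTreeIso`, ★ (W1c)-A `glVertexAct` ∕ `glTreeIso`, ★ W8-f, ★ W8-f′ inversion edition)
import Summits.HodgeConjecture.HodgeConjecture.Theorems.R90S6TreeFixDataFirstShell          -- ★ GF1: `ncard_displaced_two_inter_type_add_card_fixed_eq` (typed first shell from the fixed-vertex counts)
import HarnessLib

/-!
# R90 · S6 «Ch. 14.1–14.5 stable TF» — card W11, FILE 3b: THE TYPED TWISTED DISPLACEMENT SHELLS OF `τ_δ` ON THE TREE OF `GL₂(E_w)`, BY NAME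
# (`Theorems/R90S6TwistedShellTypedCountRankOne.lean`; DAG E1.4.4.3.2)

Cell `hodgecm-mathlib`, crux H413 (`stmt-HodgeConjecture-24833`), route of record `HCCMUnconditional`; programme R90-TF, section S6 (base `R90-C14`),
seat K2Liu-p27 (g4); S6 dealer R90-C14-plan (g3) (R55) 03:59Z «FILE 3b (typed closed-form counts by name) stays yours after F3».  Companion of FILE 3
`R90S6TwistedShellCosetsRankOne` («COSETS = TYPED VERTICES»: the twisted Cartan shell `Shell(δ, a)` of ★ J1′ counts the `τ_δ`-displaced vertices of ONE `J`-type), which is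
why the TYPED shells are the consumer's currency.  Lane `--supports stmt-HodgeConjecture-24833 --as helper`; THEOREMS ONLY (no definition, no instance, no notation, no
named-fact hypothesis, no `sorry`).

THE MATHEMATICS (Serre, *Trees* I.6.4 Prop. 24–25, II.1.1; Kottwitz 1986 §1, §3; Rogawski §4.11).  `X = latticeTree id ϖ J` the `(q_E+1)`-regular tree of `GL₂(E)`, 2-coloured
by the `J`-type (`J`-self-dual ∕ `J`-`ϖ`-modular; adjacent vertices have different types), `τ_δ = δ• ∘ θ̄` (★ FILE 1∕2), regularity as the VALUE BINDER
`hdeg : ∀ v, X.degree v = q + 1` (`q = q_E`, ★ `SLTwoTreeRegular.ncard_neighborSet_eq`).  The generic typed organs ★ W8-f (`TreeDisplacement.ncard_displaced_succ_inter_type_eq`),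
★ GF1 (`ncard_displaced_two_inter_type_add_card_fixed_eq`) and ★ W8-f′ (`ncard_dist_self_apply_eq_odd_inter_type_of_inversion`) instantiated at `α = τ_δ` with the
`J`-type colouring, the types spelled as the predicates `IsSelfDualLattice id J x.1` ∕ its negation (no colouring function is introduced):
* §1 ODD `ord det δ` (`τ_δ` inverts the edge `y ~ y′`, ★ FILE 2b `exists_swap_of_odd`): **`ncard_setOf_dist_eq_odd_and_isSelfDual_of_swap`**, **`…_and_not_isSelfDual_of_swap`**:
  `#{x : d(x, τ_δ x) = 2k+1 ∧ x self-dual} = #{… ∧ x modular} = q^k` — NO fixed-point data enters.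
* §2 EVEN `ord det δ` (`τ_δ` fixes a vertex, ★ FILE 2b `exists_glVertexAct_thetaTreeIso_eq_self_of_even`; `F = Fix τ_δ` finite): the TYPED FIRST SHELL from the fixed-vertex
  counts **`ncard_setOf_dist_eq_two_and_isSelfDual_add_ncard_fixed`** (`#{d = 2 ∧ self-dual} + #F = (q+1)·#{y ∈ F : y modular} + 1`) and its mirror
  **`…_and_not_isSelfDual_add_ncard_fixed`**, and the TYPED RECURSION **`ncard_setOf_dist_eq_two_mul_succ_and_isSelfDual`** (`#{d = 2(k+1) ∧ self-dual} = q·#{d = 2k ∧ modular}`,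
  `k ≥ 1`) and its mirror — so every typed shell, hence every `#Shell(δ, a)` (FILE 3), is an explicit polynomial in `q` and the two fixed-type counts `(#F_sd, #F_mod)`.
HONEST LABEL: count layer of E1.4.4.3.2 (G̃-side of the η̂_j clauses, Prop. 4.11.1 (b) ∕ L. 11.5.3), count-neutral until the socket consumes it; proves no printed global
statement; HC_CM is proved only modulo the 7 printed citations (2 remaining named inputs: hLiu418 = stmt-HodgeConjecture-24832, h413 = stmt-HodgeConjecture-24833) until rung 0
closes; REL ≠ ★ ≠ BUILT.

## References
* [Serre1980Trees] J.-P. Serre, *Trees* (1980), Ch. I §6.1, §6.4 Prop. 24–25; Ch. II §1.1–§1.3.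
* [Kottwitz1986BaseChangeUnits] R. Kottwitz, *Base change for unit elements of Hecke algebras*, Compositio Math. 60 (1986), §1, §3.
* [Rogawski1990] J. D. Rogawski, *Automorphic Representations of Unitary Groups in Three Variables*, Ann. of Math. Stud. 123 (1990), §4.11 pp. 58–60, L. 11.5.3 p. 155.
-/

set_option autoImplicit false
-- the mandated namespace repeats the single-problem summit's segment (`HodgeConjecture.HodgeConjecture`)
set_option linter.dupNamespace false

noncomputable section

open scoped ValuativeRel Matrix MatrixGroups
open Matrix ValuativeRel
open Literature.NumberTheory.Automorphic Literature.NumberTheory.Automorphic.HermitianLatticeTree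
open Literature.Combinatorics.SimpleGraph

namespace Summit.HodgeConjecture.HodgeConjecture.R90.S6

variable {E : Type*} [Field E] [ValuativeRel E] {ϖ : E} (hϖ : IsUniformizingElement ϖ) [IsDiscreteValuationRing 𝒪[E]]
  (σ : E →+* E) (hσv : ∀ x : E, valuation E (σ x) = valuation E x) (hσσ : ∀ x : E, σ (σ x) = x)

/-! ## §0 The `J`-type colouring -/

section Colouring

omit [IsDiscreteValuationRing 𝒪[E]] in
include hϖ in
/-- **THE `J`-TYPE 2-COLOURING**: there is `c : V → Fin 2` with `c x = 0 ↔ x` `J`-self-dual, `c x = 1 ↔` not, and adjacent vertices get different colours (★ `latticeTree_adj_iff`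
+ ★ `not_isModularLattice_of_isSelfDualLattice`).  (Used only inside proofs; no colouring is exported.) [cite: Serre1980Trees, Ch. II §1.1] -/
private theorem exists_jType :
    ∃ c : {M : Submodule 𝒪[E] (Fin 2 → E) // IsSpecialLattice (RingHom.id E) ϖ !![(0 : E), 1; -1, 0] M} → Fin 2,
      (∀ x, c x = 0 ↔ IsSelfDualLattice (RingHom.id E) !![(0 : E), 1; -1, 0] x.1) ∧ (∀ x, c x = 1 ↔ ¬ IsSelfDualLattice (RingHom.id E) !![(0 : E), 1; -1, 0] x.1) ∧
        ∀ v w, (latticeTree (RingHom.id E) ϖ !![(0 : E), 1; -1, 0]).Adj v w → c v ≠ c w := by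
  classical
  have hc0 : ∀ x : {M : Submodule 𝒪[E] (Fin 2 → E) // IsSpecialLattice (RingHom.id E) ϖ !![(0 : E), 1; -1, 0] M},
      (if IsSelfDualLattice (RingHom.id E) !![(0 : E), 1; -1, 0] x.1 then (0 : Fin 2) else 1) = 0 ↔ IsSelfDualLattice (RingHom.id E) !![(0 : E), 1; -1, 0] x.1 := fun x => by
    split_ifs with h
    · exact ⟨fun _ => h, fun _ => rfl⟩
    · exact ⟨fun h1 => absurd h1 (by decide), fun h' => absurd h' h⟩
  have hc1 : ∀ x : {M : Submodule 𝒪[E] (Fin 2 → E) // IsSpecialLattice (RingHom.id E) ϖ !![(0 : E), 1; -1, 0] M},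
      (if IsSelfDualLattice (RingHom.id E) !![(0 : E), 1; -1, 0] x.1 then (0 : Fin 2) else 1) = 1 ↔ ¬ IsSelfDualLattice (RingHom.id E) !![(0 : E), 1; -1, 0] x.1 := fun x => by
    split_ifs with h
    · exact ⟨fun h1 => absurd h1 (by decide), fun h' => absurd h h'⟩
    · exact ⟨fun _ => h, fun _ => rfl⟩
  refine ⟨fun x => if IsSelfDualLattice (RingHom.id E) !![(0 : E), 1; -1, 0] x.1 then 0 else 1, hc0, hc1, fun v w h => ?_⟩
  -- adjacent vertices have different `J`-types
  have key : IsSelfDualLattice (RingHom.id E) !![(0 : E), 1; -1, 0] v.1 ↔ ¬ IsSelfDualLattice (RingHom.id E) !![(0 : E), 1; -1, 0] w.1 := by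
    rw [latticeTree_adj_iff] at h
    obtain ⟨-, hvw | hwv⟩ := h
    · exact ⟨fun _ hw => not_isModularLattice_of_isSelfDualLattice (RingHom.id E) (fun _ => rfl) hϖ _ hw hvw.2.1, fun _ => hvw.1⟩
    · exact ⟨fun hv _ => not_isModularLattice_of_isSelfDualLattice (RingHom.id E) (fun _ => rfl) hϖ _ hv hwv.2.1, fun hw => absurd hwv.1 hw⟩
  intro hcw
  simp only at hcw
  by_cases hv : IsSelfDualLattice (RingHom.id E) !![(0 : E), 1; -1, 0] v.1
  · have h0 : (if IsSelfDualLattice (RingHom.id E) !![(0 : E), 1; -1, 0] w.1 then (0 : Fin 2) else 1) = 0 := by rw [← hcw]; exact (hc0 v).2 hv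
    exact key.1 hv ((hc0 w).1 h0)
  · have hw : IsSelfDualLattice (RingHom.id E) !![(0 : E), 1; -1, 0] w.1 := not_not.1 fun hw => hv (key.2 hw)
    have h0 : (if IsSelfDualLattice (RingHom.id E) !![(0 : E), 1; -1, 0] v.1 then (0 : Fin 2) else 1) = 0 := by rw [hcw]; exact (hc0 w).2 hw
    exact hv ((hc0 v).1 h0)

end Colouring

/-! ## §1 Odd `ord det δ`: the typed inversion shells `q^k ∣ q^k` -/

section Odd

include hσv in
/-- **TYPED INVERSION SHELL, SELF-DUAL TYPE: `#{x | d(x, τ_δ x) = 2k+1 ∧ x J-self-dual} = q^k`** when `τ_δ` inverts the edge `y ~ y′` of the `(q+1)`-regular tree (★ W8-f′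
`ncard_dist_self_apply_eq_odd_inter_type_of_inversion` at `φ = τ_δ`, colouring = `J`-type).  By FILE 3 this is `#Shell(δ, a)` for `a₀ − a₁ = 2k+1` and the self-dual parity
class. [cite: Serre1980Trees, Ch. I §6.4 Prop. 25] [cite: Rogawski1990, §4.11 pp. 58–60] -/
theorem ncard_setOf_dist_eq_odd_and_isSelfDual_of_swap
    [(latticeTree (RingHom.id E) ϖ !![(0 : E), 1; -1, 0]).LocallyFinite] (δ : GL (Fin 2) E)
    {y y' : {M : Submodule 𝒪[E] (Fin 2 → E) // IsSpecialLattice (RingHom.id E) ϖ !![(0 : E), 1; -1, 0] M}}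
    (hyy' : (latticeTree (RingHom.id E) ϖ !![(0 : E), 1; -1, 0]).Adj y y')
    (hy : glVertexAct hϖ δ (thetaTreeIso hϖ σ hσv hσσ y) = y') (hy' : glVertexAct hϖ δ (thetaTreeIso hϖ σ hσv hσσ y') = y)
    (q : ℕ) (hdeg : ∀ v : {M : Submodule 𝒪[E] (Fin 2 → E) // IsSpecialLattice (RingHom.id E) ϖ !![(0 : E), 1; -1, 0] M},
      (latticeTree (RingHom.id E) ϖ !![(0 : E), 1; -1, 0]).degree v = q + 1) (k : ℕ) :
    {x : {M : Submodule 𝒪[E] (Fin 2 → E) // IsSpecialLattice (RingHom.id E) ϖ !![(0 : E), 1; -1, 0] M} |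
        (latticeTree (RingHom.id E) ϖ !![(0 : E), 1; -1, 0]).dist x (glVertexAct hϖ δ (thetaTreeIso hϖ σ hσv hσσ x)) = 2 * k + 1 ∧
          IsSelfDualLattice (RingHom.id E) !![(0 : E), 1; -1, 0] x.1}.ncard = q ^ k := by
  obtain ⟨c, hc0, -, hc⟩ := exists_jType hϖ
  have e : {x : {M : Submodule 𝒪[E] (Fin 2 → E) // IsSpecialLattice (RingHom.id E) ϖ !![(0 : E), 1; -1, 0] M} |
      (latticeTree (RingHom.id E) ϖ !![(0 : E), 1; -1, 0]).dist x (glVertexAct hϖ δ (thetaTreeIso hϖ σ hσv hσσ x)) = 2 * k + 1 ∧ IsSelfDualLattice (RingHom.id E) !![(0 : E), 1; -1, 0] x.1} =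
      {x | (latticeTree (RingHom.id E) ϖ !![(0 : E), 1; -1, 0]).dist x (((thetaTreeIso hϖ σ hσv hσσ).trans (glTreeIso hϖ δ)) x) = 2 * k + 1 ∧ c x = 0} :=
    Set.ext fun x => by rw [Set.mem_setOf_eq, Set.mem_setOf_eq, hc0]; rfl
  rw [e]
  exact ncard_dist_self_apply_eq_odd_inter_type_of_inversion (isTree_latticeTree_id_altJ hϖ) ((thetaTreeIso hϖ σ hσv hσσ).trans (glTreeIso hϖ δ))
    hyy' hy hy' q hdeg c hc k 0

include hσv in
/-- **TYPED INVERSION SHELL, MODULAR TYPE: `#{x | d(x, τ_δ x) = 2k+1 ∧ x J-modular} = q^k`** (same, colour `1`). [cite: Serre1980Trees, Ch. I §6.4 Prop. 25]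
[cite: Rogawski1990, §4.11 pp. 58–60] -/
theorem ncard_setOf_dist_eq_odd_and_not_isSelfDual_of_swap
    [(latticeTree (RingHom.id E) ϖ !![(0 : E), 1; -1, 0]).LocallyFinite] (δ : GL (Fin 2) E)
    {y y' : {M : Submodule 𝒪[E] (Fin 2 → E) // IsSpecialLattice (RingHom.id E) ϖ !![(0 : E), 1; -1, 0] M}}
    (hyy' : (latticeTree (RingHom.id E) ϖ !![(0 : E), 1; -1, 0]).Adj y y')
    (hy : glVertexAct hϖ δ (thetaTreeIso hϖ σ hσv hσσ y) = y') (hy' : glVertexAct hϖ δ (thetaTreeIso hϖ σ hσv hσσ y') = y)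
    (q : ℕ) (hdeg : ∀ v : {M : Submodule 𝒪[E] (Fin 2 → E) // IsSpecialLattice (RingHom.id E) ϖ !![(0 : E), 1; -1, 0] M},
      (latticeTree (RingHom.id E) ϖ !![(0 : E), 1; -1, 0]).degree v = q + 1) (k : ℕ) :
    {x : {M : Submodule 𝒪[E] (Fin 2 → E) // IsSpecialLattice (RingHom.id E) ϖ !![(0 : E), 1; -1, 0] M} |
        (latticeTree (RingHom.id E) ϖ !![(0 : E), 1; -1, 0]).dist x (glVertexAct hϖ δ (thetaTreeIso hϖ σ hσv hσσ x)) = 2 * k + 1 ∧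
          ¬ IsSelfDualLattice (RingHom.id E) !![(0 : E), 1; -1, 0] x.1}.ncard = q ^ k := by
  obtain ⟨c, -, hc1, hc⟩ := exists_jType hϖ
  have e : {x : {M : Submodule 𝒪[E] (Fin 2 → E) // IsSpecialLattice (RingHom.id E) ϖ !![(0 : E), 1; -1, 0] M} |
      (latticeTree (RingHom.id E) ϖ !![(0 : E), 1; -1, 0]).dist x (glVertexAct hϖ δ (thetaTreeIso hϖ σ hσv hσσ x)) = 2 * k + 1 ∧ ¬ IsSelfDualLattice (RingHom.id E) !![(0 : E), 1; -1, 0] x.1} =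
      {x | (latticeTree (RingHom.id E) ϖ !![(0 : E), 1; -1, 0]).dist x (((thetaTreeIso hϖ σ hσv hσσ).trans (glTreeIso hϖ δ)) x) = 2 * k + 1 ∧ c x = 1} :=
    Set.ext fun x => by rw [Set.mem_setOf_eq, Set.mem_setOf_eq, hc1]; rfl
  rw [e]
  exact ncard_dist_self_apply_eq_odd_inter_type_of_inversion (isTree_latticeTree_id_altJ hϖ) ((thetaTreeIso hϖ σ hσv hσσ).trans (glTreeIso hϖ δ))
    hyy' hy hy' q hdeg c hc k 1

end Odd

/-! ## §2 Even `ord det δ`: the typed first shell from the fixed-type counts, and the typed recursion -/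

section Even

include hσv in
/-- Finite typed fixed set, read as a `Finset.filter` of the fixed set. [folklore] -/
private theorem card_filter_fixed_eq_ncard (δ : GL (Fin 2) E)
    (hfin : {v : {M : Submodule 𝒪[E] (Fin 2 → E) // IsSpecialLattice (RingHom.id E) ϖ !![(0 : E), 1; -1, 0] M} | glVertexAct hϖ δ (thetaTreeIso hϖ σ hσv hσσ v) = v}.Finite)
    (c : {M : Submodule 𝒪[E] (Fin 2 → E) // IsSpecialLattice (RingHom.id E) ϖ !![(0 : E), 1; -1, 0] M} → Fin 2) (j : Fin 2) (P : {M : Submodule 𝒪[E] (Fin 2 → E) // IsSpecialLattice (RingHom.id E) ϖ !![(0 : E), 1; -1, 0] M} → Prop) (hP : ∀ x, c x = j ↔ P x) :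
    (hfin.toFinset.filter (fun y => c y = j)).card =
      {y : {M : Submodule 𝒪[E] (Fin 2 → E) // IsSpecialLattice (RingHom.id E) ϖ !![(0 : E), 1; -1, 0] M} | glVertexAct hϖ δ (thetaTreeIso hϖ σ hσv hσσ y) = y ∧ P y}.ncard := by
  have hfin' : {y : {M : Submodule 𝒪[E] (Fin 2 → E) // IsSpecialLattice (RingHom.id E) ϖ !![(0 : E), 1; -1, 0] M} | glVertexAct hϖ δ (thetaTreeIso hϖ σ hσv hσσ y) = y ∧ P y}.Finite :=
    hfin.subset fun y hy => hy.1
  rw [Set.ncard_eq_toFinset_card _ hfin']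
  congr 1
  ext y
  rw [Finset.mem_filter, Set.Finite.mem_toFinset, Set.Finite.mem_toFinset, Set.mem_setOf_eq, Set.mem_setOf_eq, hP]

include hσv in
/-- **TYPED FIRST SHELL FROM THE FIXED-TYPE COUNTS, SELF-DUAL SIDE**: if `τ_δ` fixes a vertex and `F = Fix τ_δ` is finite, on the `(q+1)`-regular tree
`#{x | d(x, τ_δ x) = 2 ∧ x J-self-dual} + #F = (q+1) · #{y ∈ F | y J-modular} + 1` (★ GF1 `ncard_displaced_two_inter_type_add_card_fixed_eq` at `α = τ_δ`: the self-dual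
vertices at distance one from `F` hang off the modular vertices of `F`). [cite: Serre1980Trees, Ch. I §6.4 Prop. 24] [cite: Kottwitz1986BaseChangeUnits, §3] -/
theorem ncard_setOf_dist_eq_two_and_isSelfDual_add_ncard_fixed
    [DecidableEq {M : Submodule 𝒪[E] (Fin 2 → E) // IsSpecialLattice (RingHom.id E) ϖ !![(0 : E), 1; -1, 0] M}]
    [(latticeTree (RingHom.id E) ϖ !![(0 : E), 1; -1, 0]).LocallyFinite] (δ : GL (Fin 2) E)
    {u : {M : Submodule 𝒪[E] (Fin 2 → E) // IsSpecialLattice (RingHom.id E) ϖ !![(0 : E), 1; -1, 0] M}} (hu : glVertexAct hϖ δ (thetaTreeIso hϖ σ hσv hσσ u) = u)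
    (hfin : {v : {M : Submodule 𝒪[E] (Fin 2 → E) // IsSpecialLattice (RingHom.id E) ϖ !![(0 : E), 1; -1, 0] M} | glVertexAct hϖ δ (thetaTreeIso hϖ σ hσv hσσ v) = v}.Finite)
    (q : ℕ) (hdeg : ∀ v : {M : Submodule 𝒪[E] (Fin 2 → E) // IsSpecialLattice (RingHom.id E) ϖ !![(0 : E), 1; -1, 0] M},
      (latticeTree (RingHom.id E) ϖ !![(0 : E), 1; -1, 0]).degree v = q + 1) :
    {x : {M : Submodule 𝒪[E] (Fin 2 → E) // IsSpecialLattice (RingHom.id E) ϖ !![(0 : E), 1; -1, 0] M} |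
        (latticeTree (RingHom.id E) ϖ !![(0 : E), 1; -1, 0]).dist x (glVertexAct hϖ δ (thetaTreeIso hϖ σ hσv hσσ x)) = 2 ∧ IsSelfDualLattice (RingHom.id E) !![(0 : E), 1; -1, 0] x.1}.ncard +
        {v : {M : Submodule 𝒪[E] (Fin 2 → E) // IsSpecialLattice (RingHom.id E) ϖ !![(0 : E), 1; -1, 0] M} | glVertexAct hϖ δ (thetaTreeIso hϖ σ hσv hσσ v) = v}.ncard =
      (q + 1) * {y : {M : Submodule 𝒪[E] (Fin 2 → E) // IsSpecialLattice (RingHom.id E) ϖ !![(0 : E), 1; -1, 0] M} | glVertexAct hϖ δ (thetaTreeIso hϖ σ hσv hσσ y) = y ∧ ¬ IsSelfDualLattice (RingHom.id E) !![(0 : E), 1; -1, 0] y.1}.ncard + 1 := by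
  obtain ⟨c, hc0, hc1, hc⟩ := exists_jType hϖ
  have h := ncard_displaced_two_inter_type_add_card_fixed_eq (isTree_latticeTree_id_altJ hϖ) ((thetaTreeIso hϖ σ hσv hσσ).trans (glTreeIso hϖ δ)) hu hfin c hc
    Fin.zero_ne_one (fun _ => q + 1) (fun y _ => hdeg y)
  have e : {x : {M : Submodule 𝒪[E] (Fin 2 → E) // IsSpecialLattice (RingHom.id E) ϖ !![(0 : E), 1; -1, 0] M} |
      (latticeTree (RingHom.id E) ϖ !![(0 : E), 1; -1, 0]).dist x (glVertexAct hϖ δ (thetaTreeIso hϖ σ hσv hσσ x)) = 2 ∧ IsSelfDualLattice (RingHom.id E) !![(0 : E), 1; -1, 0] x.1} =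
      {x | (latticeTree (RingHom.id E) ϖ !![(0 : E), 1; -1, 0]).dist x (((thetaTreeIso hϖ σ hσv hσσ).trans (glTreeIso hϖ δ)) x) = 2 ∧ c x = 0} :=
    Set.ext fun x => by rw [Set.mem_setOf_eq, Set.mem_setOf_eq, hc0]; rfl
  rw [e, ← card_filter_fixed_eq_ncard hϖ σ hσv hσσ δ hfin c 1 _ hc1, Set.ncard_eq_toFinset_card _ hfin]
  exact h

include hσv in
/-- **TYPED FIRST SHELL FROM THE FIXED-TYPE COUNTS, MODULAR SIDE**: `#{x | d(x, τ_δ x) = 2 ∧ x J-modular} + #F = (q+1) · #{y ∈ F | y J-self-dual} + 1`.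
[cite: Serre1980Trees, Ch. I §6.4 Prop. 24] [cite: Kottwitz1986BaseChangeUnits, §3] -/
theorem ncard_setOf_dist_eq_two_and_not_isSelfDual_add_ncard_fixed
    [DecidableEq {M : Submodule 𝒪[E] (Fin 2 → E) // IsSpecialLattice (RingHom.id E) ϖ !![(0 : E), 1; -1, 0] M}]
    [(latticeTree (RingHom.id E) ϖ !![(0 : E), 1; -1, 0]).LocallyFinite] (δ : GL (Fin 2) E)
    {u : {M : Submodule 𝒪[E] (Fin 2 → E) // IsSpecialLattice (RingHom.id E) ϖ !![(0 : E), 1; -1, 0] M}} (hu : glVertexAct hϖ δ (thetaTreeIso hϖ σ hσv hσσ u) = u)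
    (hfin : {v : {M : Submodule 𝒪[E] (Fin 2 → E) // IsSpecialLattice (RingHom.id E) ϖ !![(0 : E), 1; -1, 0] M} | glVertexAct hϖ δ (thetaTreeIso hϖ σ hσv hσσ v) = v}.Finite)
    (q : ℕ) (hdeg : ∀ v : {M : Submodule 𝒪[E] (Fin 2 → E) // IsSpecialLattice (RingHom.id E) ϖ !![(0 : E), 1; -1, 0] M},
      (latticeTree (RingHom.id E) ϖ !![(0 : E), 1; -1, 0]).degree v = q + 1) :
    {x : {M : Submodule 𝒪[E] (Fin 2 → E) // IsSpecialLattice (RingHom.id E) ϖ !![(0 : E), 1; -1, 0] M} |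
        (latticeTree (RingHom.id E) ϖ !![(0 : E), 1; -1, 0]).dist x (glVertexAct hϖ δ (thetaTreeIso hϖ σ hσv hσσ x)) = 2 ∧ ¬ IsSelfDualLattice (RingHom.id E) !![(0 : E), 1; -1, 0] x.1}.ncard +
        {v : {M : Submodule 𝒪[E] (Fin 2 → E) // IsSpecialLattice (RingHom.id E) ϖ !![(0 : E), 1; -1, 0] M} | glVertexAct hϖ δ (thetaTreeIso hϖ σ hσv hσσ v) = v}.ncard =
      (q + 1) * {y : {M : Submodule 𝒪[E] (Fin 2 → E) // IsSpecialLattice (RingHom.id E) ϖ !![(0 : E), 1; -1, 0] M} | glVertexAct hϖ δ (thetaTreeIso hϖ σ hσv hσσ y) = y ∧ IsSelfDualLattice (RingHom.id E) !![(0 : E), 1; -1, 0] y.1}.ncard + 1 := by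
  obtain ⟨c, hc0, hc1, hc⟩ := exists_jType hϖ
  have h := ncard_displaced_two_inter_type_add_card_fixed_eq (isTree_latticeTree_id_altJ hϖ) ((thetaTreeIso hϖ σ hσv hσσ).trans (glTreeIso hϖ δ)) hu hfin c hc
    Fin.zero_ne_one.symm (fun _ => q + 1) (fun y _ => hdeg y)
  have e : {x : {M : Submodule 𝒪[E] (Fin 2 → E) // IsSpecialLattice (RingHom.id E) ϖ !![(0 : E), 1; -1, 0] M} |
      (latticeTree (RingHom.id E) ϖ !![(0 : E), 1; -1, 0]).dist x (glVertexAct hϖ δ (thetaTreeIso hϖ σ hσv hσσ x)) = 2 ∧ ¬ IsSelfDualLattice (RingHom.id E) !![(0 : E), 1; -1, 0] x.1} =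
      {x | (latticeTree (RingHom.id E) ϖ !![(0 : E), 1; -1, 0]).dist x (((thetaTreeIso hϖ σ hσv hσσ).trans (glTreeIso hϖ δ)) x) = 2 ∧ c x = 1} :=
    Set.ext fun x => by rw [Set.mem_setOf_eq, Set.mem_setOf_eq, hc1]; rfl
  rw [e, ← card_filter_fixed_eq_ncard hϖ σ hσv hσσ δ hfin c 0 _ hc0, Set.ncard_eq_toFinset_card _ hfin]
  exact h

include hσv in
/-- **TYPED RECURSION, SELF-DUAL SIDE: `#{x | d(x, τ_δ x) = 2(k+1) ∧ x J-self-dual} = q · #{x | d(x, τ_δ x) = 2k ∧ x J-modular}`** (`k ≥ 1`; ★ W8-f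
`TreeDisplacement.ncard_displaced_succ_inter_type_eq` at `α = τ_δ`: each moved vertex has `q` children one step further from `Fix τ_δ`, of the other type).
[cite: Serre1980Trees, Ch. I §6.4 Prop. 24] [cite: Kottwitz1986BaseChangeUnits, §3] -/
theorem ncard_setOf_dist_eq_two_mul_succ_and_isSelfDual
    [(latticeTree (RingHom.id E) ϖ !![(0 : E), 1; -1, 0]).LocallyFinite] (δ : GL (Fin 2) E)
    {u : {M : Submodule 𝒪[E] (Fin 2 → E) // IsSpecialLattice (RingHom.id E) ϖ !![(0 : E), 1; -1, 0] M}} (hu : glVertexAct hϖ δ (thetaTreeIso hϖ σ hσv hσσ u) = u)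
    (hfin : {v : {M : Submodule 𝒪[E] (Fin 2 → E) // IsSpecialLattice (RingHom.id E) ϖ !![(0 : E), 1; -1, 0] M} | glVertexAct hϖ δ (thetaTreeIso hϖ σ hσv hσσ v) = v}.Finite)
    (q : ℕ) (hdeg : ∀ v : {M : Submodule 𝒪[E] (Fin 2 → E) // IsSpecialLattice (RingHom.id E) ϖ !![(0 : E), 1; -1, 0] M},
      (latticeTree (RingHom.id E) ϖ !![(0 : E), 1; -1, 0]).degree v = q + 1) {k : ℕ} (hk : 1 ≤ k) :
    {x : {M : Submodule 𝒪[E] (Fin 2 → E) // IsSpecialLattice (RingHom.id E) ϖ !![(0 : E), 1; -1, 0] M} |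
        (latticeTree (RingHom.id E) ϖ !![(0 : E), 1; -1, 0]).dist x (glVertexAct hϖ δ (thetaTreeIso hϖ σ hσv hσσ x)) = 2 * (k + 1) ∧ IsSelfDualLattice (RingHom.id E) !![(0 : E), 1; -1, 0] x.1}.ncard =
      q * {x : {M : Submodule 𝒪[E] (Fin 2 → E) // IsSpecialLattice (RingHom.id E) ϖ !![(0 : E), 1; -1, 0] M} |
        (latticeTree (RingHom.id E) ϖ !![(0 : E), 1; -1, 0]).dist x (glVertexAct hϖ δ (thetaTreeIso hϖ σ hσv hσσ x)) = 2 * k ∧ ¬ IsSelfDualLattice (RingHom.id E) !![(0 : E), 1; -1, 0] x.1}.ncard := by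
  obtain ⟨c, hc0, hc1, hc⟩ := exists_jType hϖ
  have h := TreeDisplacement.ncard_displaced_succ_inter_type_eq (isTree_latticeTree_id_altJ hϖ) ((thetaTreeIso hϖ σ hσv hσσ).trans (glTreeIso hϖ δ)) hu hfin c hc
    (fun _ => q) (fun v _ => hdeg v) Fin.zero_ne_one hk
  have e₁ : {x : {M : Submodule 𝒪[E] (Fin 2 → E) // IsSpecialLattice (RingHom.id E) ϖ !![(0 : E), 1; -1, 0] M} |
      (latticeTree (RingHom.id E) ϖ !![(0 : E), 1; -1, 0]).dist x (glVertexAct hϖ δ (thetaTreeIso hϖ σ hσv hσσ x)) = 2 * (k + 1) ∧ IsSelfDualLattice (RingHom.id E) !![(0 : E), 1; -1, 0] x.1} =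
      {x | (latticeTree (RingHom.id E) ϖ !![(0 : E), 1; -1, 0]).dist x (((thetaTreeIso hϖ σ hσv hσσ).trans (glTreeIso hϖ δ)) x) = 2 * (k + 1) ∧ c x = 0} :=
    Set.ext fun x => by rw [Set.mem_setOf_eq, Set.mem_setOf_eq, hc0]; rfl
  have e₂ : {x : {M : Submodule 𝒪[E] (Fin 2 → E) // IsSpecialLattice (RingHom.id E) ϖ !![(0 : E), 1; -1, 0] M} |
      (latticeTree (RingHom.id E) ϖ !![(0 : E), 1; -1, 0]).dist x (glVertexAct hϖ δ (thetaTreeIso hϖ σ hσv hσσ x)) = 2 * k ∧ ¬ IsSelfDualLattice (RingHom.id E) !![(0 : E), 1; -1, 0] x.1} =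
      {x | (latticeTree (RingHom.id E) ϖ !![(0 : E), 1; -1, 0]).dist x (((thetaTreeIso hϖ σ hσv hσσ).trans (glTreeIso hϖ δ)) x) = 2 * k ∧ c x = 1} :=
    Set.ext fun x => by rw [Set.mem_setOf_eq, Set.mem_setOf_eq, hc1]; rfl
  rw [e₁, e₂, h]

include hσv in
/-- **TYPED RECURSION, MODULAR SIDE: `#{x | d(x, τ_δ x) = 2(k+1) ∧ x J-modular} = q · #{x | d(x, τ_δ x) = 2k ∧ x J-self-dual}`** (`k ≥ 1`).
[cite: Serre1980Trees, Ch. I §6.4 Prop. 24] [cite: Kottwitz1986BaseChangeUnits, §3] -/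
theorem ncard_setOf_dist_eq_two_mul_succ_and_not_isSelfDual
    [(latticeTree (RingHom.id E) ϖ !![(0 : E), 1; -1, 0]).LocallyFinite] (δ : GL (Fin 2) E)
    {u : {M : Submodule 𝒪[E] (Fin 2 → E) // IsSpecialLattice (RingHom.id E) ϖ !![(0 : E), 1; -1, 0] M}} (hu : glVertexAct hϖ δ (thetaTreeIso hϖ σ hσv hσσ u) = u)
    (hfin : {v : {M : Submodule 𝒪[E] (Fin 2 → E) // IsSpecialLattice (RingHom.id E) ϖ !![(0 : E), 1; -1, 0] M} | glVertexAct hϖ δ (thetaTreeIso hϖ σ hσv hσσ v) = v}.Finite)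
    (q : ℕ) (hdeg : ∀ v : {M : Submodule 𝒪[E] (Fin 2 → E) // IsSpecialLattice (RingHom.id E) ϖ !![(0 : E), 1; -1, 0] M},
      (latticeTree (RingHom.id E) ϖ !![(0 : E), 1; -1, 0]).degree v = q + 1) {k : ℕ} (hk : 1 ≤ k) :
    {x : {M : Submodule 𝒪[E] (Fin 2 → E) // IsSpecialLattice (RingHom.id E) ϖ !![(0 : E), 1; -1, 0] M} |
        (latticeTree (RingHom.id E) ϖ !![(0 : E), 1; -1, 0]).dist x (glVertexAct hϖ δ (thetaTreeIso hϖ σ hσv hσσ x)) = 2 * (k + 1) ∧ ¬ IsSelfDualLattice (RingHom.id E) !![(0 : E), 1; -1, 0] x.1}.ncard =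
      q * {x : {M : Submodule 𝒪[E] (Fin 2 → E) // IsSpecialLattice (RingHom.id E) ϖ !![(0 : E), 1; -1, 0] M} |
        (latticeTree (RingHom.id E) ϖ !![(0 : E), 1; -1, 0]).dist x (glVertexAct hϖ δ (thetaTreeIso hϖ σ hσv hσσ x)) = 2 * k ∧ IsSelfDualLattice (RingHom.id E) !![(0 : E), 1; -1, 0] x.1}.ncard := by
  obtain ⟨c, hc0, hc1, hc⟩ := exists_jType hϖ
  have h := TreeDisplacement.ncard_displaced_succ_inter_type_eq (isTree_latticeTree_id_altJ hϖ) ((thetaTreeIso hϖ σ hσv hσσ).trans (glTreeIso hϖ δ)) hu hfin c hc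
    (fun _ => q) (fun v _ => hdeg v) Fin.zero_ne_one.symm hk
  have e₁ : {x : {M : Submodule 𝒪[E] (Fin 2 → E) // IsSpecialLattice (RingHom.id E) ϖ !![(0 : E), 1; -1, 0] M} |
      (latticeTree (RingHom.id E) ϖ !![(0 : E), 1; -1, 0]).dist x (glVertexAct hϖ δ (thetaTreeIso hϖ σ hσv hσσ x)) = 2 * (k + 1) ∧ ¬ IsSelfDualLattice (RingHom.id E) !![(0 : E), 1; -1, 0] x.1} =
      {x | (latticeTree (RingHom.id E) ϖ !![(0 : E), 1; -1, 0]).dist x (((thetaTreeIso hϖ σ hσv hσσ).trans (glTreeIso hϖ δ)) x) = 2 * (k + 1) ∧ c x = 1} :=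
    Set.ext fun x => by rw [Set.mem_setOf_eq, Set.mem_setOf_eq, hc1]; rfl
  have e₂ : {x : {M : Submodule 𝒪[E] (Fin 2 → E) // IsSpecialLattice (RingHom.id E) ϖ !![(0 : E), 1; -1, 0] M} |
      (latticeTree (RingHom.id E) ϖ !![(0 : E), 1; -1, 0]).dist x (glVertexAct hϖ δ (thetaTreeIso hϖ σ hσv hσσ x)) = 2 * k ∧ IsSelfDualLattice (RingHom.id E) !![(0 : E), 1; -1, 0] x.1} =
      {x | (latticeTree (RingHom.id E) ϖ !![(0 : E), 1; -1, 0]).dist x (((thetaTreeIso hϖ σ hσv hσσ).trans (glTreeIso hϖ δ)) x) = 2 * k ∧ c x = 0} :=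
    Set.ext fun x => by rw [Set.mem_setOf_eq, Set.mem_setOf_eq, hc0]; rfl
  rw [e₁, e₂, h]

end Even

end Summit.HodgeConjecture.HodgeConjecture.R90.S6

end
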